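import Summits.CriticalPhenomena.CardyFormulaZ2.Theorems.CardyComplexConeEdgePrecompactUFRSJunctionFunnelFrame

/-!
# The junction funnel, part H: rotation frames, the reference box, colours near the junction
(line `qkz-strip-boundary-arm` of crux `CardyComplexCone.EdgePrecompact`, stmt-CriticalPhenomena-11387;
eighth file of the registered sub-goal S2 = `ufrs_junctionFunnel`, lead c5, wave 4; registered
anchor `junction_colours_JF`; continues `…UFRSJunctionFunnelFrame.lean`)

* `exists_rot_JF`, `rot_symm_JF`, `frame_symm_apply_JF`, `frame_symm_coord_JF`, `refbox_JF` — the
  four rotation frames of `ℤ²` exist, the inverse frame is the opposite rotation, and under a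
  rotation frame the lattice box of the datum and its four sides become a box and its sides.
* `colour_chain_JF` — along a chain of lattice-adjacent boundary sites spanning no marked edge
  the colour (wired / free arc) propagates (admissibility: the arcs partition the boundary and
  an `A`–`B` edge of `Ω_δ` is marked).
* `junction_colours_JF` (registered anchor) — in the reference picture of the gate (junction at
  the origin on the bottom row, resp. near the box corner on one of its legs; the second marked
  edge far away) the bottom row is wired on one side and free on the other (flat), resp. the
  column leg is wired and the row leg free beyond the junction (corner): straight chains from the
  two junction sites, through the box corner in the corner case.

References: S. Smirnov, C. R. Acad. Sci. Paris 333 (2001), §2 (Dobrushin arcs).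
-/

set_option linter.unusedVariables false

namespace Summit.CriticalPhenomena.CardyFormulaZ2.Cruxes.EdgePrecompact.QkzStripBoundaryArm

open MeasureTheory Filter Set Metric
open scoped Topology BigOperators Pointwise
open Literature.Probability.LatticeModels Literature.Probability.Percolation
open Literature.Probability.RandomPlanarGeometry (DobrushinDomain)
open Summit.CriticalPhenomena.CardyFormulaZ2.Theses.CardyComplexCone

noncomputable section

/-! ## Rotation frames: existence, the inverse frame, the reference box -/

/-- **The four rotation frames exist**: for every `j : Fin 4` there is a signed coordinate
permutation `σ` of `ℤ²` with `σ (cornerUnit k) = cornerUnit (k + j)` for all `k`. -/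
theorem exists_rot_JF (j : Fin 4) :
    ∃ (π : Equiv.Perm (Fin 2)) (ε : Fin 2 → ℤˣ), ∀ k, Site.signedPerm π ε (cornerUnit k) = cornerUnit (k + j) := by
  fin_cases j
  · exact ⟨1, fun _ => 1, fun k => by fin_cases k <;> decide⟩
  · exact ⟨Equiv.swap 0 1, fun i => if i = 0 then -1 else 1, fun k => by fin_cases k <;> decide⟩
  · exact ⟨1, fun _ => -1, fun k => by fin_cases k <;> decide⟩
  · exact ⟨Equiv.swap 0 1, fun i => if i = 0 then 1 else -1, fun k => by fin_cases k <;> decide⟩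

/-- The inverse of a rotation frame is the opposite rotation. -/
theorem rot_symm_JF {π : Equiv.Perm (Fin 2)} {ε : Fin 2 → ℤˣ} {j : Fin 4}
    (hrot : ∀ k, Site.signedPerm π ε (cornerUnit k) = cornerUnit (k + j)) (k : Fin 4) :
    Site.signedPerm π.symm (ε ∘ π) (cornerUnit k) = cornerUnit (k + -j) := by
  rw [← Site.signedPerm_symm, Equiv.symm_apply_eq, hrot, neg_add_cancel_right]

/-- The inverse frame map: `ψ⁻¹ z = σ⁻¹ z + n`. -/
theorem frame_symm_apply_JF (π : Equiv.Perm (Fin 2)) (ε : Fin 2 → ℤˣ) (n z : Site 2) :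
    ((zdShiftIso (-n)).trans (zdSignedPermIso π ε)).symm z = Site.signedPerm π.symm (ε ∘ π) z + n := by
  rw [RelIso.symm_apply_eq, frame_apply_JF, add_sub_cancel_right, ← Site.signedPerm_symm, Equiv.apply_symm_apply]

/-- **Coordinates of the inverse frame**: `ψ⁻¹ z = n + z₀ u_{-j} + z₁ u_{1-j}` in coordinates. -/
theorem frame_symm_coord_JF {π : Equiv.Perm (Fin 2)} {ε : Fin 2 → ℤˣ} {j : Fin 4}
    (hrot : ∀ k, Site.signedPerm π ε (cornerUnit k) = cornerUnit (k + j)) (n z : Site 2) :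
    ((zdShiftIso (-n)).trans (zdSignedPermIso π ε)).symm z 0 = n 0 + z 0 * cornerUnit (-j) 0 + z 1 * cornerUnit (-j + 1) 0 ∧
      ((zdShiftIso (-n)).trans (zdSignedPermIso π ε)).symm z 1 = n 1 + z 0 * cornerUnit (-j) 1 + z 1 * cornerUnit (-j + 1) 1 := by
  obtain ⟨h0, h1⟩ := frame_coord_JF (rot_symm_JF hrot) z
  rw [frame_symm_apply_JF]
  simp only [Pi.add_apply]
  constructor <;> [rw [h0]; rw [h1]] <;> ring

/-- The frame applied after the inverse frame. -/
theorem frame_apply_symm_JF (π : Equiv.Perm (Fin 2)) (ε : Fin 2 → ℤˣ) (n z : Site 2) :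
    Site.signedPerm π ε (((zdShiftIso (-n)).trans (zdSignedPermIso π ε)).symm z - n) = z := by
  rw [← frame_apply_JF π ε n, RelIso.apply_symm_apply]

/-- **The reference box.** Under a rotation frame the lattice box `[i₀, i₁] × [j₀, j₁]` and its
four sides become a box `[I₀, I₁] × [J₀, J₁]` and its four sides. -/
theorem refbox_JF {π : Equiv.Perm (Fin 2)} {ε : Fin 2 → ℤˣ} {j : Fin 4}
    (hrot : ∀ k, Site.signedPerm π ε (cornerUnit k) = cornerUnit (k + j)) (n : Site 2) (i₀ i₁ j₀ j₁ : ℤ) :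
    ∃ I₀ I₁ J₀ J₁ : ℤ, ∀ z : Site 2,
      ((i₀ ≤ ((zdShiftIso (-n)).trans (zdSignedPermIso π ε)).symm z 0 ∧ ((zdShiftIso (-n)).trans (zdSignedPermIso π ε)).symm z 0 ≤ i₁ ∧
        j₀ ≤ ((zdShiftIso (-n)).trans (zdSignedPermIso π ε)).symm z 1 ∧ ((zdShiftIso (-n)).trans (zdSignedPermIso π ε)).symm z 1 ≤ j₁) ↔
        (I₀ ≤ z 0 ∧ z 0 ≤ I₁ ∧ J₀ ≤ z 1 ∧ z 1 ≤ J₁)) ∧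
      ((((zdShiftIso (-n)).trans (zdSignedPermIso π ε)).symm z 0 = i₀ ∨ ((zdShiftIso (-n)).trans (zdSignedPermIso π ε)).symm z 0 = i₁ ∨
        ((zdShiftIso (-n)).trans (zdSignedPermIso π ε)).symm z 1 = j₀ ∨ ((zdShiftIso (-n)).trans (zdSignedPermIso π ε)).symm z 1 = j₁) ↔
        (z 0 = I₀ ∨ z 0 = I₁ ∨ z 1 = J₀ ∨ z 1 = J₁)) := by
  have key := fun z => frame_symm_coord_JF hrot n z
  rcases corner_coord_JF (-j) with h | h | h | h
  · refine ⟨i₀ - n 0, i₁ - n 0, j₀ - n 1, j₁ - n 1, fun z => ?_⟩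
    obtain ⟨k0, k1⟩ := key z
    norm_num only [h.1, h.2.1, h.2.2.1, h.2.2.2.1] at k0 k1
    rw [k0, k1]; omega
  · refine ⟨j₀ - n 1, j₁ - n 1, n 0 - i₁, n 0 - i₀, fun z => ?_⟩
    obtain ⟨k0, k1⟩ := key z
    norm_num only [h.1, h.2.1, h.2.2.1, h.2.2.2.1] at k0 k1
    rw [k0, k1]; omega
  · refine ⟨n 0 - i₁, n 0 - i₀, n 1 - j₁, n 1 - j₀, fun z => ?_⟩
    obtain ⟨k0, k1⟩ := key z
    norm_num only [h.1, h.2.1, h.2.2.1, h.2.2.2.1] at k0 k1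
    rw [k0, k1]; omega
  · refine ⟨n 1 - j₁, n 1 - j₀, i₀ - n 0, i₁ - n 0, fun z => ?_⟩
    obtain ⟨k0, k1⟩ := key z
    norm_num only [h.1, h.2.1, h.2.2.1, h.2.2.2.1] at k0 k1
    rw [k0, k1]; omega

/-! ## Colour propagation along chains of boundary sites -/

/-- Unordered pairs of pulled-back sites are equal only if the pairs are. -/
theorem sym2_symm_inj_JF (Ψ : zdGraph 2 ≃g zdGraph 2) {a b c d : Site 2}
    (h : s(Ψ.symm a, Ψ.symm b) = s(Ψ.symm c, Ψ.symm d)) : s(a, b) = s(c, d) := by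
  rcases Sym2.eq_iff.1 h with ⟨h1, h2⟩ | ⟨h1, h2⟩
  · rw [Ψ.symm.injective h1, Ψ.symm.injective h2]
  · rw [Ψ.symm.injective h1, Ψ.symm.injective h2, Sym2.eq_swap]

/-- **Colour propagation.** Along a chain of lattice-adjacent reference sites whose pull-backs are
discrete boundary sites of rectangle data and span no marked (`A`–`B`) edge, the colour (wired /
free arc) of the first site propagates to all. -/
theorem colour_chain_JF {F : DiscreteDobrushin} {x₀ x₁ y₀ y₁ : ℝ} (hF : F.IsZdAdmissible)
    (hFΩ : F.Ω = Set.Ioo x₀ x₁ ×ℂ Set.Ioo y₀ y₁) (Ψ : zdGraph 2 ≃g zdGraph 2) (γ : ℕ → Site 2) (L : ℕ)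
    (hadj : ∀ i, i < L → (zdGraph 2).Adj (γ i) (γ (i + 1)))
    (hbd : ∀ i, i ≤ L → Ψ.symm (γ i) ∈ F.zdBoundary)
    (hne : ∀ i, i < L → s(Ψ.symm (γ i), Ψ.symm (γ (i + 1))) ∉ F.zdABEdges) :
    (Ψ.symm (γ 0) ∈ F.zdArcA → ∀ i, i ≤ L → Ψ.symm (γ i) ∈ F.zdArcA) ∧
      (Ψ.symm (γ 0) ∈ F.zdArcB → ∀ i, i ≤ L → Ψ.symm (γ i) ∈ F.zdArcB) := by
  have hedge : ∀ i, i < L → s(Ψ.symm (γ i), Ψ.symm (γ (i + 1))) ∈ (discreteDomainGraph F.Ω F.δ).edgeSet := by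
    intro i hi
    rw [SimpleGraph.mem_edgeSet, dom_adj_iff_rect hF hFΩ, ← meshDomain_eq_rect hF hFΩ]
    exact ⟨Ψ.symm.map_rel_iff.2 (hadj i hi), F.zdBoundary_subset_meshDomain (hbd i hi.le),
      F.zdBoundary_subset_meshDomain (hbd (i + 1) hi)⟩
  constructor
  · intro h0 i
    induction i with
    | zero => intro _; exact h0
    | succ i ih =>
      intro hi
      have hiA := ih (by omega)
      rcases hF.zdBoundary_subset (hbd (i + 1) hi) with hA | hB
      · exact hA
      · exact absurd ⟨hedge i hi, ⟨_, Sym2.mem_mk_left _ _, hiA⟩, ⟨_, Sym2.mem_mk_right _ _, hB⟩⟩ (hne i hi)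
  · intro h0 i
    induction i with
    | zero => intro _; exact h0
    | succ i ih =>
      intro hi
      have hiB := ih (by omega)
      rcases hF.zdBoundary_subset (hbd (i + 1) hi) with hA | hB
      · exact absurd ⟨hedge i hi, ⟨_, Sym2.mem_mk_right _ _, hA⟩, ⟨_, Sym2.mem_mk_left _ _, hiB⟩⟩ (hne i hi)
      · exact hB

/-- **The colours near the junction** (registered anchor `junction_colours_JF` of
stmt-CriticalPhenomena-11387). In a rotation frame `ψ` placing the junction `{nA, nB}`
(`nA` wired, `nB` free) of `ℤ²`-admissible rectangle data `F` at the origin of the reference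
picture — FLAT: `nA ↦ (0,0)`, `nB ↦ (-s, 0)` on the bottom row `J₀ = 0` of the reference box;
CORNER: box in the quadrant `{x₁ ≥ 0, s x₀ ≥ 0}`, junction on the column `x₀ = 0` at height `t₀`
(`onA`) or on the row `x₁ = 0` at `s x₀ = t₀` — and with the only other marked edge `eF` beyond
sup-distance `Lc`, the bottom row is wired on `0 ≤ s x₀ ≤ Lc` and free on `1 ≤ -s x₀ ≤ Lc`
(flat), resp. the column is wired on `t₀ ≤ x₁ ≤ Lc` and the row free on `t₀ ≤ s x₀ ≤ Lc` (corner).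
Proof: colour propagation (`colour_chain_JF`) along straight chains of boundary sites starting at
`nA`, `nB` (through the box corner in the corner case), which span neither `{nA, nB}` (positions)
nor `eF` (too far). -/
theorem junction_colours_JF : ∀ (F : DiscreteDobrushin) (x₀ x₁ y₀ y₁ : ℝ), F.IsZdAdmissible → F.Ω = Set.Ioo x₀ x₁ ×ℂ Set.Ioo y₀ y₁ → ∀ (Ψ : zdGraph 2 ≃g zdGraph 2) (I₀ I₁ J₀ J₁ Lc : ℤ) (s : ℤ) (corner onA : Bool) (t₀ : ℤ) (nA nB : Site 2) (eF : Sym2 (Site 2)), (∀ z : Site 2, Ψ.symm z ∈ F.zdBoundary ↔ (I₀ ≤ z 0 ∧ z 0 ≤ I₁ ∧ J₀ ≤ z 1 ∧ z 1 ≤ J₁) ∧ (z 0 = I₀ ∨ z 0 = I₁ ∨ z 1 = J₀ ∨ z 1 = J₁)) → (s = 1 ∨ s = -1) → nA ∈ F.zdArcA → nB ∈ F.zdArcB → (∀ e ∈ F.zdABEdges, e = s(nA, nB) ∨ e = eF) → (∀ x ∈ eF, Lc + 1 ≤ |Ψ x 0| ∨ Lc + 1 ≤ |Ψ x 1|) →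 0 ≤ Lc → J₀ = 0 → Lc ≤ J₁ → (corner = false → I₀ ≤ -Lc ∧ Lc ≤ I₁ ∧ nA = Ψ.symm ![0, 0] ∧ nB = Ψ.symm ![-s, 0]) → (corner = true → 1 ≤ t₀ ∧ t₀ ≤ Lc ∧ (s = 1 → I₀ = 0 ∧ Lc ≤ I₁) ∧ (s = -1 → I₁ = 0 ∧ I₀ ≤ -Lc) ∧ (onA = true → nA = Ψ.symm ![0, t₀] ∧ nB = Ψ.symm ![0, t₀ - 1]) ∧ (onA = false → nB = Ψ.symm ![s * t₀, 0] ∧ nA = Ψ.symm ![s * (t₀ - 1), 0])) → (corner = false → (∀ x : ℤ, 0 ≤ s * x → s * x ≤ Lc → Ψ.symm ![x, 0] ∈ F.zdArcA) ∧ (∀ x : ℤ, 1 ≤ -s * x → -s * x ≤ Lc → Ψ.symm ![x, 0] ∈ F.zdArcB)) ∧ (corner = true → (∀ y : ℤ, t₀ ≤ y → y ≤ Lc → Ψ.symm ![0, y] ∈ F.zdArcA) ∧ (∀ x : ℤ, t₀ ≤ s * x → s * x ≤ Lc → Ψ.symm ![x, 0] ∈ F.zdArcB)) := by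
  intro F x₀ x₁ y₀ y₁ hF hFΩ Ψ I₀ I₁ J₀ J₁ Lc s corner onA t₀ nA nB eF hbdry hs hA hB hAB hfar hLc hJ₀ hJ₁ hflat hcor
  subst hJ₀
  -- a chain point is never an endpoint of the far marked edge
  have hnotfar : ∀ z : Site 2, |z 0| ≤ Lc → |z 1| ≤ Lc → Ψ.symm z ∉ eF := by
    intro z h0 h1 hz
    have := hfar _ hz
    rw [RelIso.apply_symm_apply] at this
    omega
  -- the generic straight chain: `γ i = (a + i dx, b + i dy)`
  have chain : ∀ (a b dx dy : ℤ) (L : ℕ), ((dx = 1 ∨ dx = -1) ∧ dy = 0) ∨ (dx = 0 ∧ (dy = 1 ∨ dy = -1)) →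
      (∀ i : ℕ, (i : ℤ) ≤ L → (I₀ ≤ a + i * dx ∧ a + i * dx ≤ I₁ ∧ 0 ≤ b + i * dy ∧ b + i * dy ≤ J₁) ∧
        (a + i * dx = I₀ ∨ a + i * dx = I₁ ∨ b + i * dy = 0 ∨ b + i * dy = J₁) ∧ |a + i * dx| ≤ Lc ∧ |b + i * dy| ≤ Lc) →
      (∀ i : ℕ, (i : ℤ) < L → s(![a + i * dx, b + i * dy], ![a + (i + 1) * dx, b + (i + 1) * dy]) ≠ s(Ψ (nA), Ψ (nB))) →
      (Ψ.symm ![a, b] ∈ F.zdArcA → ∀ i : ℕ, (i : ℤ) ≤ L → Ψ.symm ![a + i * dx, b + i * dy] ∈ F.zdArcA) ∧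
      (Ψ.symm ![a, b] ∈ F.zdArcB → ∀ i : ℕ, (i : ℤ) ≤ L → Ψ.symm ![a + i * dx, b + i * dy] ∈ F.zdArcB) := by
    intro a b dx dy L hd hpts hne0
    have key := colour_chain_JF hF hFΩ Ψ (fun i : ℕ => ![a + i * dx, b + i * dy]) L ?_ ?_ ?_
    · simp only [Nat.cast_zero, zero_mul, add_zero] at key
      exact ⟨fun h i hi => key.1 h i (by exact_mod_cast hi), fun h i hi => key.2 h i (by exact_mod_cast hi)⟩
    · intro i hi
      rw [adj_iff_coord_JF]
      simp only [Matrix.cons_val_zero, Matrix.cons_val_one, Nat.cast_add, Nat.cast_one]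
      rcases hd with ⟨hdx | hdx, hdy⟩ | ⟨hdx, hdy | hdy⟩ <;> subst hdx <;> subst hdy <;> omega
    · intro i hi
      rw [hbdry]
      simp only [Matrix.cons_val_zero, Matrix.cons_val_one]
      exact ⟨(hpts i (by exact_mod_cast hi)).1, (hpts i (by exact_mod_cast hi)).2.1⟩
    · intro i hi hmem
      rcases hAB _ hmem with he | he
      · apply hne0 i (by exact_mod_cast hi)
        have he' : s(Ψ.symm ![a + i * dx, b + i * dy], Ψ.symm ![a + (i + 1) * dx, b + (i + 1) * dy]) =
            s(Ψ.symm (Ψ nA), Ψ.symm (Ψ nB)) := by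
          rw [RelIso.symm_apply_apply, RelIso.symm_apply_apply]; exact_mod_cast he
        exact sym2_symm_inj_JF Ψ he'
      · have hi' : (i : ℤ) < L := by exact_mod_cast hi
        have h1 := hpts i (by omega)
        exact hnotfar _ (by simp only [Matrix.cons_val_zero]; exact h1.2.2.1)
          (by simp only [Matrix.cons_val_one]; exact h1.2.2.2) (he ▸ Sym2.mem_mk_left _ _)
  have hΨA : ∀ z : Site 2, nA = Ψ.symm z → Ψ nA = z := fun z h => by rw [h, RelIso.apply_symm_apply]
  have hΨB : ∀ z : Site 2, nB = Ψ.symm z → Ψ nB = z := fun z h => by rw [h, RelIso.apply_symm_apply]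
  constructor
  · -- FLAT
    intro hc
    obtain ⟨hI₀, hI₁, hnA, hnB⟩ := hflat hc
    have eA := hΨA _ hnA
    have eB := hΨB _ hnB
    obtain ⟨L, hL⟩ : ∃ L : ℕ, (L : ℤ) = Lc := ⟨Lc.toNat, by omega⟩
    constructor
    · -- the wired side: chain `(s i, 0)`
      have key := (chain 0 0 s 0 L (Or.inl ⟨hs, rfl⟩) ?_ ?_).1 (by rw [← hnA]; exact hA)
      · intro x hx1 hx2
        obtain ⟨i, hi⟩ : ∃ i : ℕ, (i : ℤ) = s * x := ⟨(s * x).toNat, by omega⟩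
        have := key i (by omega)
        have e1 : (0 : ℤ) + i * s = x := by rw [hi]; rcases hs with rfl | rfl <;> ring
        have e2 : (0 : ℤ) + i * 0 = 0 := by ring
        rwa [e1, e2] at this
      · intro i hi; rcases hs with rfl | rfl <;> simp only [abs_le] <;> omega
      · intro i hi heq
        rw [eA, eB, sym2_eq_iff_coord_JF] at heq
        simp only [Matrix.cons_val_zero, Matrix.cons_val_one] at heq
        rcases hs with rfl | rfl <;> push_cast at heq <;> omega
    · -- the free side: chain `(-s - s i, 0)`
      intro x hx1 hx2
      obtain ⟨L', hL'⟩ : ∃ L' : ℕ, (L' : ℤ) = Lc - 1 := ⟨(Lc - 1).toNat, by omega⟩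
      have key := (chain (-s) 0 (-s) 0 L' (Or.inl ⟨by omega, rfl⟩) ?_ ?_).2 (by rw [← hnB]; exact hB)
      · obtain ⟨i, hi⟩ : ∃ i : ℕ, (i : ℤ) = -s * x - 1 := ⟨(-s * x - 1).toNat, by omega⟩
        have := key i (by omega)
        have e1 : -s + i * -s = x := by
          rcases hs with rfl | rfl
          · omega
          · omega
        have e2 : (0 : ℤ) + i * 0 = 0 := by ring
        rwa [e1, e2] at this
      · intro i hi; rcases hs with rfl | rfl <;> simp only [abs_le] <;> omega
      · intro i hi heq
        rw [eA, eB, sym2_eq_iff_coord_JF] at heq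
        simp only [Matrix.cons_val_zero, Matrix.cons_val_one] at heq
        rcases hs with rfl | rfl <;> push_cast at heq <;> omega
  · -- CORNER
    intro hc
    obtain ⟨ht₀, ht₀L, hI1, hI2, honA, hoffA⟩ := hcor hc
    obtain ⟨L, hL⟩ : ∃ L : ℕ, (L : ℤ) = Lc := ⟨Lc.toNat, by omega⟩
    have hbox0 : (s = 1 → I₀ = 0 ∧ Lc ≤ I₁) ∧ (s = -1 → I₁ = 0 ∧ I₀ ≤ -Lc) := ⟨hI1, hI2⟩
    -- the colour of the box corner `(0,0)` and the two straight chains from it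
    have hcolumn : ∀ y₀' : ℤ, 0 ≤ y₀' → y₀' ≤ Lc → Ψ.symm ![0, y₀'] ∈ F.zdArcA →
        (∀ i : ℕ, (i : ℤ) < Lc - y₀' → s(![(0 : ℤ) + i * 0, y₀' + i * 1], ![(0 : ℤ) + (i + 1) * 0, y₀' + (i + 1) * 1]) ≠ s(Ψ nA, Ψ nB)) →
        ∀ y : ℤ, y₀' ≤ y → y ≤ Lc → Ψ.symm ![0, y] ∈ F.zdArcA := by
      intro y₀' hy₀ hy₀L hstart hne y hy1 hy2
      obtain ⟨L', hL'⟩ : ∃ L' : ℕ, (L' : ℤ) = Lc - y₀' := ⟨(Lc - y₀').toNat, by omega⟩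
      have key := (chain 0 y₀' 0 1 L' (Or.inr ⟨rfl, Or.inl rfl⟩) ?_ (fun i hi => hne i (by omega))).1
        (by simpa using hstart)
      · obtain ⟨i, hi⟩ : ∃ i : ℕ, (i : ℤ) = y - y₀' := ⟨(y - y₀').toNat, by omega⟩
        have := key i (by omega)
        have e1 : (0 : ℤ) + i * 0 = 0 := by ring
        have e2 : y₀' + i * 1 = y := by omega
        rwa [e1, e2] at this
      · intro i hi; rcases hs with rfl | rfl <;> simp only [abs_le] <;> omega
    have hrow : ∀ x₀' : ℤ, 0 ≤ x₀' → x₀' ≤ Lc → Ψ.symm ![s * x₀', 0] ∈ F.zdArcB →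
        (∀ i : ℕ, (i : ℤ) < Lc - x₀' → s(![s * x₀' + i * s, (0 : ℤ) + i * 0], ![s * x₀' + (i + 1) * s, (0 : ℤ) + (i + 1) * 0]) ≠ s(Ψ nA, Ψ nB)) →
        ∀ x : ℤ, x₀' ≤ s * x → s * x ≤ Lc → Ψ.symm ![x, 0] ∈ F.zdArcB := by
      intro x₀' hx₀ hx₀L hstart hne x hx1 hx2
      obtain ⟨L', hL'⟩ : ∃ L' : ℕ, (L' : ℤ) = Lc - x₀' := ⟨(Lc - x₀').toNat, by omega⟩
      have key := (chain (s * x₀') 0 s 0 L' (Or.inl ⟨hs, rfl⟩) ?_ (fun i hi => hne i (by omega))).2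
        (by simpa using hstart)
      · obtain ⟨i, hi⟩ : ∃ i : ℕ, (i : ℤ) = s * x - x₀' := ⟨(s * x - x₀').toNat, by omega⟩
        have := key i (by omega)
        have e1 : s * x₀' + i * s = x := by rw [hi]; rcases hs with rfl | rfl <;> ring
        have e2 : (0 : ℤ) + i * 0 = 0 := by ring
        rwa [e1, e2] at this
      · intro i hi; rcases hs with rfl | rfl <;> simp only [abs_le] <;> omega
    cases onA
    · -- junction on the row: `nB = (s t₀, 0)`, `nA = (s (t₀ - 1), 0)`
      obtain ⟨hnB, hnA⟩ := hoffA rfl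
      have eA := hΨA _ hnA
      have eB := hΨB _ hnB
      -- wired chain from `nA` along the row to the corner `(0, 0)`
      obtain ⟨L₁, hL₁⟩ : ∃ L₁ : ℕ, (L₁ : ℤ) = t₀ - 1 := ⟨(t₀ - 1).toNat, by omega⟩
      have key₁ := (chain (s * (t₀ - 1)) 0 (-s) 0 L₁ (Or.inl ⟨by omega, rfl⟩) ?_ ?_).1 (by rw [← hnA]; exact hA)
      · have h00 : Ψ.symm ![0, 0] ∈ F.zdArcA := by
          have := key₁ L₁ le_rfl
          have e1 : s * (t₀ - 1) + (L₁ : ℤ) * -s = 0 := by rw [hL₁]; ring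
          have e2 : (0 : ℤ) + (L₁ : ℤ) * 0 = 0 := by ring
          rwa [e1, e2] at this
        have hcolA' : ∀ y : ℤ, 0 ≤ y → y ≤ Lc → Ψ.symm ![0, y] ∈ F.zdArcA := by
          refine hcolumn 0 le_rfl hLc h00 ?_
          intro i hi heq
          rw [eA, eB, sym2_eq_iff_coord_JF] at heq
          simp only [Matrix.cons_val_zero, Matrix.cons_val_one] at heq
          rcases hs with rfl | rfl <;> omega
        refine ⟨fun y hy1 hy2 => hcolA' y (by omega) hy2, ?_⟩
        refine hrow t₀ (by omega) ht₀L (by rw [← hnB]; exact hB) ?_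
        intro i hi heq
        rw [eA, eB, sym2_eq_iff_coord_JF] at heq
        simp only [Matrix.cons_val_zero, Matrix.cons_val_one] at heq
        rcases hs with rfl | rfl <;> omega
      · intro i hi; rcases hs with rfl | rfl <;> simp only [abs_le] <;> omega
      · intro i hi heq
        rw [eA, eB, sym2_eq_iff_coord_JF] at heq
        simp only [Matrix.cons_val_zero, Matrix.cons_val_one] at heq
        rcases hs with rfl | rfl <;> push_cast at heq <;> omega
    · -- junction on the column: `nA = (0, t₀)`, `nB = (0, t₀ - 1)`
      obtain ⟨hnA, hnB⟩ := honA rfl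
      have eA := hΨA _ hnA
      have eB := hΨB _ hnB
      -- free chain from `nB` down the column to the corner `(0, 0)`
      obtain ⟨L₁, hL₁⟩ : ∃ L₁ : ℕ, (L₁ : ℤ) = t₀ - 1 := ⟨(t₀ - 1).toNat, by omega⟩
      have key₁ := (chain 0 (t₀ - 1) 0 (-1) L₁ (Or.inr ⟨rfl, Or.inr rfl⟩) ?_ ?_).2 (by rw [← hnB]; exact hB)
      · have h00 : Ψ.symm ![0, 0] ∈ F.zdArcB := by
          have := key₁ L₁ le_rfl
          have e1 : (0 : ℤ) + (L₁ : ℤ) * 0 = 0 := by ring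
          have e2 : t₀ - 1 + (L₁ : ℤ) * -1 = 0 := by rw [hL₁]; ring
          rwa [e1, e2] at this
        refine ⟨hcolumn t₀ (by omega) ht₀L (by rw [← hnA]; exact hA) ?_, ?_⟩
        · intro i hi heq
          rw [eA, eB, sym2_eq_iff_coord_JF] at heq
          simp only [Matrix.cons_val_zero, Matrix.cons_val_one] at heq
          omega
        · have h00' : Ψ.symm ![s * 0, 0] ∈ F.zdArcB := by rwa [mul_zero]
          have := hrow 0 le_rfl hLc h00' ?_
          · exact fun x hx1 hx2 => this x (by omega) hx2
          intro i hi heq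
          rw [eA, eB, sym2_eq_iff_coord_JF] at heq
          simp only [Matrix.cons_val_zero, Matrix.cons_val_one] at heq
          rcases hs with rfl | rfl <;> push_cast at heq <;> omega
      · intro i hi; rcases hs with rfl | rfl <;> simp only [abs_le] <;> omega
      · intro i hi heq
        rw [eA, eB, sym2_eq_iff_coord_JF] at heq
        simp only [Matrix.cons_val_zero, Matrix.cons_val_one] at heq
        omega

end

end Summit.CriticalPhenomena.CardyFormulaZ2.Cruxes.EdgePrecompact.QkzStripBoundaryArm
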